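import Literature.NumberTheory.EllipticCurves.BurungaleSkinner2023.RankOneTwistsPAdicRegulator
import HarnessLib

/-!
# Burungale–Skinner 2023 — the case `ϕ = 1` of a RATIONAL point of order `p` (PROVED bookkeeping)

A. Burungale, C. Skinner, Proc. AMS Ser. B 10 (2023), remark after Lemma 2.3 (p. 17): "Note that
this lemma applies to any `E/ℚ` with a rational point of order `p` for a prime `p ∤ 2N` (take `Φ` to
be the subgroup generated by such a point)."  All the worked examples of the paper are of this kind
((E1) `14.a3`, (E2) `20.a3`, (E3), (E4) `11.a2`, (E5) `26b2`: "`ϕ = 1`", pp. 22–24).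

When `Γ_ℚ` acts trivially on the line `Φ ≤ E[p](ℚ̄)` — which is the case when `Φ` consists of (base
changes of) rational points, by Galois descent `E(ℚ̄)^{Γ_ℚ} = E(ℚ)` (tree theorem
`WeierstrassCurve.fixedPoints_eq_range_map_holds`) — the character `ϕ` is trivial, so every
`ϕ`-hypothesis of `Thm28Hypotheses` / `Thm210Hypotheses` / Thm. 2.11 in
`RankOneTwistsPAdicRegulator.lean` holds for free: `ϕ` is even, unramified everywhere, of order
dividing `2`, `ϕ(ℓ) = +1` at every `ℓ`, and `K_{ϕψ} = K_ψ` (`IsProductCharacterField W p Φ K K` for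
every QUADRATIC number field `K`: the two embeddings of `K` into `ℚ̄` have the same image because a
quadratic extension is normal — Mathlib `Algebra.IsQuadraticExtension.normal`,
`AlgHom.restrictNormal`). Theorems only; no new facts.

References: [BurungaleSkinner2023] remark after Lemma 2.3 (p. 17), Examples (E1)–(E5) (pp. 22–24);
[SilvermanAEC2009] VIII.§1 (Galois descent for points).
-/

noncomputable section

open scoped Classical

open NumberField IsDedekindDomain WeierstrassCurve
  Literature.NumberTheory.EllipticCurves Literature.NumberTheory.EllipticCurves.Rank1Residual

namespace Literature.NumberTheory.EllipticCurves.BurungaleSkinner2023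

/-! ### Rational points are Galois-fixed -/

section Fixed

variable {W : WeierstrassCurve ℚ} {p : ℕ} [Fact p.Prime]

/-- A geometric point which is the base change of a rational point is fixed by `Γ_ℚ` (Galois descent,
the easy inclusion `E(ℚ) ⊆ E(ℚ̄)^{Γ_ℚ}` of the tree theorem `fixedPoints_eq_range_map_holds`).
[cite: SilvermanAEC2009, VIII.§1 (proof of Prop. 1.2)] -/
theorem smul_eq_self_of_mem_range_baseChange {P : geomPoints W}
    (hP : P ∈ Set.range (fun Q : (W.baseChange ℚ).toAffine.Point =>
      (Affine.Point.baseChange ℚ (AlgebraicClosure ℚ) Q : geomPoints W)))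
    (σ : Field.absoluteGaloisGroup ℚ) : σ • P = P := by
  have h := W.fixedPoints_eq_range_map_holds
  have hmem : P ∈ MulAction.fixedPoints (Field.absoluteGaloisGroup ℚ) (geomPoints W) := by
    rw [h]; exact hP
  exact hmem σ

omit [Fact p.Prime] in
/-- **"`ϕ = 1`" for a line of rational points.** If every element of the line `Φ ≤ E[p](ℚ̄)` is the
base change of a rational point ("take `Φ` to be the subgroup generated by [a rational point of order
`p`]"), then `Γ_ℚ` acts trivially on `Φ`. [cite: BurungaleSkinner2023, remark after Lemma 2.3 (p. 17)] -/
theorem forall_smul_eq_of_forall_mem_range_baseChange {Φ : AddSubgroup (geomTorsion W (p : ℤ))}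
    (hΦ : ∀ P ∈ Φ, (P : geomPoints W) ∈ Set.range (fun Q : (W.baseChange ℚ).toAffine.Point =>
      (Affine.Point.baseChange ℚ (AlgebraicClosure ℚ) Q : geomPoints W))) :
    ∀ (σ : Field.absoluteGaloisGroup ℚ), ∀ P ∈ Φ, σ • P = P := by
  intro σ P hP
  apply Subtype.ext
  exact smul_eq_self_of_mem_range_baseChange (hΦ P hP) σ

end Fixed

/-! ### Consequences of `ϕ = 1` for the hypotheses of Theorems 2.8–2.11 -/

section Trivial

variable {W : WeierstrassCurve ℚ} {p : ℕ} [Fact p.Prime] {Φ : AddSubgroup (geomTorsion W (p : ℤ))}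

/-- `ϕ = 1` is even. [cite: BurungaleSkinner2023, remark after Lemma 2.3 (p. 17)] -/
theorem lineEven_of_forall_smul_eq (hΦ : ∀ (σ : Field.absoluteGaloisGroup ℚ), ∀ P ∈ Φ, σ • P = P) :
    LineEven W p Φ :=
  fun c _ P hP => hΦ c P hP

/-- `ϕ = 1` is unramified at `p`. [cite: BurungaleSkinner2023, remark after Lemma 2.3 (p. 17)] -/
theorem lineUnramifiedAt_of_forall_smul_eq
    (hΦ : ∀ (σ : Field.absoluteGaloisGroup ℚ), ∀ P ∈ Φ, σ • P = P) : LineUnramifiedAt W p Φ :=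
  fun _ _ _ _ σ _ P hP => hΦ σ P hP

omit [Fact p.Prime] in
/-- `ϕ = 1` is unramified at every prime `ℓ`. [cite: BurungaleSkinner2023, remark after Lemma 2.3 (p. 17)] -/
theorem lineUnramifiedAtPrime_of_forall_smul_eq
    (hΦ : ∀ (σ : Field.absoluteGaloisGroup ℚ), ∀ P ∈ Φ, σ • P = P) (ℓ : ℕ) :
    LineUnramifiedAtPrime W p Φ ℓ :=
  fun _ _ _ _ σ _ P hP => hΦ σ P hP

omit [Fact p.Prime] in
/-- `ϕ = 1` has order dividing `2`. [cite: BurungaleSkinner2023, remark after Lemma 2.3 (p. 17)] -/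
theorem lineOrderDvdTwo_of_forall_smul_eq
    (hΦ : ∀ (σ : Field.absoluteGaloisGroup ℚ), ∀ P ∈ Φ, σ • P = P) : LineOrderDvdTwo W p Φ := by
  intro σ P hP
  rw [hΦ σ P hP, hΦ σ P hP]

omit [Fact p.Prime] in
/-- `ϕ = 1` takes the value `+1` at every prime `ℓ`. [cite: BurungaleSkinner2023, remark after Lemma 2.3 (p. 17)] -/
theorem lineFrobeniusFixesAt_of_forall_smul_eq
    (hΦ : ∀ (σ : Field.absoluteGaloisGroup ℚ), ∀ P ∈ Φ, σ • P = P) (ℓ : ℕ) :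
    LineFrobeniusFixesAt W p Φ ℓ :=
  fun _ _ _ _ σ _ P hP => hΦ σ P hP

end Trivial

/-! ### `K_{ϕψ} = K_ψ` when `ϕ = 1`: the two embeddings of a quadratic field have the same image -/

section Quadratic

/-- For a QUADRATIC number field `K` (hence normal over `ℚ`), any two embeddings
`ι, ι' : K → ℚ̄` have the same image: every `ι' x` is of the form `ι y` (Mathlib
`AlgHom.restrictNormal` along `ι`). [folklore] -/
private theorem exists_apply_eq_of_finrank_eq_two {K : Type} [Field K] [NumberField K]
    (hK : Module.finrank ℚ K = 2) (ι ι' : K →+* AlgebraicClosure ℚ) (x : K) :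
    ∃ y : K, ι' x = ι y := by
  haveI : Algebra.IsQuadraticExtension ℚ K := { finrank_eq_two' := hK }
  letI : Algebra K (AlgebraicClosure ℚ) := ι.toAlgebra
  haveI : IsScalarTower ℚ K (AlgebraicClosure ℚ) :=
    IsScalarTower.of_algebraMap_eq' (Subsingleton.elim _ _)
  let φ : K →ₐ[ℚ] AlgebraicClosure ℚ := ι'.toRatAlgHom
  refine ⟨φ.restrictNormal K x, ?_⟩
  have h := φ.restrictNormal_commutes K x
  have h1 : algebraMap K (AlgebraicClosure ℚ) (φ.restrictNormal K x) = ι (φ.restrictNormal K x) :=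
    rfl
  have h2 : φ (algebraMap K K x) = ι' x := rfl
  rw [h1, h2] at h
  exact h.symm

/-- **`IsProductCharacterField W p Φ K K` when `ϕ = 1`** (`K_{ϕψ} = K_ψ`): for a quadratic number
field `K` and a line `Φ` with trivial `Γ_ℚ`-action the product-character condition "σ fixes `K'` iff
(σ fixes `K` iff σ fixes `Φ`)" holds with `K' = K` — for every pair of embeddings, since both have the
same image. So in `Thm28Hypotheses` / `Thm210Hypotheses` one may take `K' = K` for a curve with a
rational point of order `p` ((E1)–(E5): "`ϕ = 1`"). [cite: BurungaleSkinner2023, remark after Lemma 2.3 (p. 17) and Examples (E1)–(E5) (pp. 22–24)] -/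
theorem isProductCharacterField_self_of_forall_smul_eq {W : WeierstrassCurve ℚ} {p : ℕ}
    [Fact p.Prime] {Φ : AddSubgroup (geomTorsion W (p : ℤ))}
    (hΦ : ∀ (σ : Field.absoluteGaloisGroup ℚ), ∀ P ∈ Φ, σ • P = P)
    (K : Type) [Field K] [NumberField K] (hK : Module.finrank ℚ K = 2) :
    IsProductCharacterField W p Φ K K := by
  intro ι ι' σ
  have htriv : (∀ P ∈ Φ, σ • P = P) ↔ True := ⟨fun _ => trivial, fun _ => hΦ σ⟩
  rw [htriv, iff_true]
  constructor
  · intro h x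
    obtain ⟨y, hy⟩ := exists_apply_eq_of_finrank_eq_two hK ι' ι x
    rw [hy, h y]
  · intro h x
    obtain ⟨y, hy⟩ := exists_apply_eq_of_finrank_eq_two hK ι ι' x
    rw [hy, h y]

/-- The same with the tree predicate `IsImaginaryQuadratic K` (`[K : ℚ] = 2`, no real place).
[cite: BurungaleSkinner2023, remark after Lemma 2.3 (p. 17)] -/
theorem isProductCharacterField_self_of_isImaginaryQuadratic {W : WeierstrassCurve ℚ} {p : ℕ}
    [Fact p.Prime] {Φ : AddSubgroup (geomTorsion W (p : ℤ))}
    (hΦ : ∀ (σ : Field.absoluteGaloisGroup ℚ), ∀ P ∈ Φ, σ • P = P)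
    (K : Type) [Field K] [NumberField K] (hK : IsImaginaryQuadratic K) :
    IsProductCharacterField W p Φ K K :=
  isProductCharacterField_self_of_forall_smul_eq hΦ K hK.1

end Quadratic

end Literature.NumberTheory.EllipticCurves.BurungaleSkinner2023

end
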